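import Summits.HodgeConjecture.HodgeConjecture.Theorems.F0P3SpectralJunction
import HarnessLib

/-!
# Crux `HLiu418`, line `F0_AlbCm`, stub `stub_S1_betti` (n = 2 slice) — the FORMAL `L²` SPECTRAL JUNCTION for SCALAR forms (J1′₂ ∕ J1″₂)

Floor-0 programme P5 (Alb-CM), seat F0P5-p03 (g0) (B2 seat 2, the `n = 2` slice of `stub_S1_betti : S1BettiShape` of
`Cruxes/HLiu418/Lines/F0_AlbCm.lean`); crux item stmt-HodgeConjecture-24832 (`HCCMUnconditional.HLiu418`).
HC_CM is proved only modulo the 7 printed citations until rung 0 closes; this file is letter-free and `sorry`-free and closes nothing by itself.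

The `n = 2` slice reads [Liu2021, Prop. D.4 (1)] («`dim Hom_{G(𝔸^∞)}(π^∞, H¹_B(Sh, ℂ)) = 1`», proof p. 130–131: Matsushima +
[Rogawski1990, §11] multiplicity formula) in FUNCTION-SPACE currency over the SCALAR cotangent automorphic forms of the unitary Shimura
CURVES of `U(J)`, `J ∈ M₂`, (the carriers `UnitaryCurveForms.holCotForms₂ ∕ cohForms₂ ∕ rightRep₂`, A-p01 (g12) M2, functions
`U(J)(𝔸_F) → ℂ`), exactly as programme P3's line `F0_U3CohMultOne` reads [Liu2021, Prop. 4.13] over `ℂ²`-valued forms of `U(2,1)`.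
The engine letters (the `n = 2` twins E1₂ ∕ E1′₂ ∕ E2′₂θ ∕ (D)(E)₂ of ★ `Rogawski1990/CohomologicalSpectrumInnerForm` and ★
`Automorphic/UnitaryGroupCotangentSpectralProjection`) speak about ONE discrete automorphic representation `P ≤ L²(U(J)(F)\U(J)(𝔸_F), μ)`
through ★ `DiscreteAutomorphicRep.HasFinComponent` (generic in `N`); the slice's function-space waypoints (the `n = 2` twins of P3's
S3 ∕ S4 ∕ S5) speak about `U(J)(𝔸_{F,f})`-equivariant linear maps `ψ : σ → (U(J)(𝔸_F) → ℂ)`.  This file is the SCALAR twin of the formal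
half of that junction, ★ `Theorems/F0P3SpectralJunction.lean` §3 + §5 (F0P3-p02 (g0)), GENERIC over the unitary datum
`UnitaryGroup.adelicGroupData F E c N J` (any `N`; used at `N = 2`), with the equivariance spelled on values
(`ψ (σ g w) x = ψ w (x · (1, g))`, which is `UnitaryCurveForms.rightRep₂_apply` by `rfl` at `N = 2`, so that no carrier file is imported):

* J1′₂ `exists_discreteAutomorphicRep_not_orthogonal_hasFinComponent`: `σ` IRREDUCIBLE on `W`, `ψ ≠ 0` equivariant with values
  left-`U(J)(F)`-invariant and CONTINUOUS on `U(J)(𝔸_F)`, `μ` automorphic on the COMPACT quotient with `L²(μ)` discretely decomposable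
  ⇒ some discrete automorphic `P` is NOT ORTHOGONAL to the class `[toQuotFun (ψ w)]` of some value and has finite component `σ`
  (`P.HasFinComponent σ`, the intertwiner being `pr_P ∘ [·] ∘ ψ`);
* J1″₂ `hasFinComponent_of_not_orthogonal`: the same conclusion for EVERY discrete `P` meeting the class of a value of `ψ` (no discrete
  decomposability);
* `memLp_toQuotFun`: classes of continuous left-invariant scalar functions on the compact quotient are `L²`.
The `L²` bookkeeping (`toQuotFun_ne_zero`, `toQuotFun_rightTranslate`, `memLp_of_continuous`, `toLp_eq_memLp_toLp`, `rightRegular_toLp`)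
and the Hilbert-space lemmas (`exists_irreducible_not_orthogonal`, `orthogonalProjectionOnto_map ∕ _ne_zero`) are ★ and imported BY NAME
from `F0P3SpectralJunction` ∕ `F0P3HilbertProjection` ∕ `H413SpectrumJunction`.

References: [BorelJacquet1979] Corvallis PSPM 33.1 §4.6 (`L²_d`, `π ≅ ⊗ π_v`); [Dixmier1977] *C*-algebras* §13.1; [Liu2021]
arXiv:2102.11518 = Camb. J. Math. 9 (2021), Prop. D.4 (1) p. 130–131, App. D l. 5357–5359; [Rogawski1990] Ann. of Math. Stud. 123, §11.
-/

-- the mandated namespace repeats `HodgeConjecture.HodgeConjecture`, as in every `Theorems/*.lean` of this sub-problem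
set_option linter.dupNamespace false

noncomputable section

open MeasureTheory NumberField MulAction
open scoped InnerProductSpace ENNReal

namespace Summit.HodgeConjecture.HodgeConjecture.Cruxes.HLiu418.ScalarSpectralJunction

open Literature.NumberTheory.Automorphic
open Literature.NumberTheory.Automorphic.UnitaryGroup
open Literature.NumberTheory.Automorphic.UnitaryGroup.CotangentForms (toQuotFun toQuotFun_mk)
open Summit.HodgeConjecture.HodgeConjecture.Cruxes.H413.F0P3HilbertProjection
open Summit.HodgeConjecture.HodgeConjecture.Cruxes.H413.SpectrumJunction
open Summit.HodgeConjecture.HodgeConjecture.Cruxes.H413.F0P3SpectralJunction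

/-! ## §1 `L²` classes of continuous left-invariant scalar functions on a compact automorphic quotient -/

section QuotFun

variable {K : Type} [Field K] [NumberField K] {𝒢 : AdelicGroupData.{0} K}
  {μ : Measure 𝒢.automorphicQuotient} [𝒢.IsAutomorphicMeasure μ] [CompactSpace 𝒢.automorphicQuotient]

/-- On a COMPACT automorphic quotient, the descent `toQuotFun Φ` of a continuous left-`A_G G(K)`-invariant scalar function `Φ` on
`G(𝔸_K)` is square-integrable for the (finite) automorphic measure. [cite: BorelJacquet1979, §4.6] -/
theorem memLp_toQuotFun {Φ : 𝒢.Adelic → ℂ} (hΦ : ∀ γ ∈ 𝒢.quotientSubgroup, ∀ g, Φ (γ * g) = Φ g) (hc : Continuous Φ) :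
    MemLp (toQuotFun 𝒢 Φ) 2 μ :=
  memLp_of_continuous (continuous_toQuotFun hΦ hc)

end QuotFun

/-! ## §2 The scalar junction J1′₂ ∕ J1″₂ for a unitary group `U(J)`, `J ∈ M_N(E)` (used at `N = 2`) -/

section Junction

variable {F E : Type} [Field F] [NumberField F] [Field E] [NumberField E] [Algebra F E]
  {c : E ≃ₐ[F] E} {N : ℕ} {J : Matrix (Fin N) (Fin N) E}
  {μ : Measure (adelicGroupData F E c N J).automorphicQuotient} [(adelicGroupData F E c N J).IsAutomorphicMeasure μ]
  [CompactSpace (adelicGroupData F E c N J).automorphicQuotient]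

/-- **The class map of an equivariant scalar-form-valued linear map.**  For `ψ : W →ₗ[ℂ] (U(J)(𝔸_F) → ℂ)` with left-`U(J)(F)`-invariant
continuous values, `w ↦ [toQuotFun (ψ w)] ∈ L²(μ)` is a `ℂ`-linear map which intertwines `σ` with the right regular representation along
`U(J)(𝔸_{F,f}) → U(J)(𝔸_F)` whenever `ψ` is equivariant for right translation (`ψ (σ g w) x = ψ w (x · (1,g))`), and which is non-zero
wherever `ψ` is. [cite: BorelJacquet1979, §4.2 and §4.6] -/
theorem exists_classMap {W : Type} [AddCommGroup W] [Module ℂ W] (σ : Representation ℂ (finAdelic F E c N J) W)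
    (ψ : W →ₗ[ℂ] ((adelicGroupData F E c N J).Adelic → ℂ))
    (heqv : ∀ (g : finAdelic F E c N J) (w : W) (x : (adelicGroupData F E c N J).Adelic),
      ψ (σ g w) x = ψ w (x * finAdelicToAdelic F E c N J g))
    (hinv : ∀ (w : W), ∀ γ ∈ (adelicGroupData F E c N J).quotientSubgroup, ∀ x, ψ w (γ * x) = ψ w x)
    (hcont : ∀ w : W, Continuous (ψ w)) :
    ∃ cl : W →ₗ[ℂ] (adelicGroupData F E c N J).L2 μ,
      (∀ w : W, cl w = (memLp_toQuotFun (μ := μ) (hinv w) (hcont w)).toLp) ∧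
      (∀ (g : finAdelic F E c N J) (w : W),
        cl (σ g w) = (adelicGroupData F E c N J).rightRegular μ (finAdelicToAdelic F E c N J g) (cl w)) ∧
      ∀ (w : W) (x : (adelicGroupData F E c N J).Adelic), ψ w x ≠ 0 → cl w ≠ 0 := by
  -- continuity of the descended values
  have hcont' : ∀ w : W, Continuous (toQuotFun (adelicGroupData F E c N J) (ψ w)) :=
    fun w => continuous_toQuotFun (hinv w) (hcont w)
  -- the continuous-function-valued map `w ↦ toQuotFun (ψ w)`, additive and homogeneous
  let φ : W → C((adelicGroupData F E c N J).automorphicQuotient, ℂ) := fun w =>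
    ⟨toQuotFun (adelicGroupData F E c N J) (ψ w), hcont' w⟩
  have hφ_add : ∀ w w', φ (w + w') = φ w + φ w' := fun w w' => by
    ext q
    simp only [φ, map_add, ContinuousMap.coe_mk, ContinuousMap.add_apply, toQuotFun, Pi.add_apply]
  have hφ_smul : ∀ (r : ℂ) (w : W), φ (r • w) = r • φ w := fun r w => by
    ext q
    simp only [φ, map_smul, ContinuousMap.coe_mk, ContinuousMap.smul_apply, toQuotFun, Pi.smul_apply]
  let cl : W →ₗ[ℂ] (adelicGroupData F E c N J).L2 μ :=
    { toFun := fun w => ContinuousMap.toLp (E := ℂ) 2 μ ℂ (φ w)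
      map_add' := fun w w' => by simp only [hφ_add, map_add]
      map_smul' := fun r w => by simp only [hφ_smul, map_smul, RingHom.id_apply] }
  have hcl_apply : ∀ w, cl w = ContinuousMap.toLp (E := ℂ) 2 μ ℂ (φ w) := fun w => rfl
  refine ⟨cl, fun w => ?_, fun g w => ?_, fun w x hx h0 => ?_⟩
  · -- the class is the `MemLp.toLp` class
    rw [hcl_apply]
    exact toLp_eq_memLp_toLp (μ := μ) (φ w) _
  · -- equivariance: right translation descends to the regular representation
    rw [hcl_apply, hcl_apply, rightRegular_toLp]
    congr 1
    ext q
    have hψ : ψ (σ g w) = fun x => ψ w (x * finAdelicToAdelic F E c N J g) := funext (heqv g w)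
    have key := congrFun (toQuotFun_rightTranslate (𝒢 := adelicGroupData F E c N J) (Φ := ψ w) (hinv w)
      (finAdelicToAdelic F E c N J g)) q
    simp only [φ, hψ, ContinuousMap.coe_mk, ContinuousMap.comp_apply]
    exact key
  · -- non-vanishing: a non-zero value has a non-zero descent, hence a non-zero class (continuous representative)
    have h1 : φ w = 0 := ContinuousMap.toLp_injective (E := ℂ) (p := (2 : ℝ≥0∞)) (𝕜 := ℂ) μ (by
      rw [map_zero]; exact h0)
    have h2 := congrArg (fun f : C((adelicGroupData F E c N J).automorphicQuotient, ℂ) =>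
      f ((adelicGroupData F E c N J).toAutomorphicQuotient x⁻¹)) h1
    simp only [φ, ContinuousMap.coe_mk, ContinuousMap.zero_apply] at h2
    exact toQuotFun_ne_zero (hinv w) hx h2

omit [CompactSpace (adelicGroupData F E c N J).automorphicQuotient] in
/-- **The intertwiner `pr_P ∘ cl : σ → P|_{U(J)(𝔸_{F,f})}` and its injectivity.**  For a discrete automorphic `P` and a class map `cl` as
in `exists_classMap`, orthogonal projection onto `P` gives a `U(J)(𝔸_{F,f})`-intertwiner `σ → P.finRep`; if `σ` is irreducible and `P` is
not orthogonal to some class `cl w₀`, it is injective, so `σ` OCCURS in `P` (`P.HasFinComponent σ`). [cite: BorelJacquet1979, §4.6]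
[cite: Dixmier1977, §13.1] -/
theorem hasFinComponent_of_classMap (P : DiscreteAutomorphicRep (adelicGroupData F E c N J) μ)
    {W : Type} [AddCommGroup W] [Module ℂ W] (σ : Representation ℂ (finAdelic F E c N J) W) (hσ : σ.IsIrreducible)
    (cl : W →ₗ[ℂ] (adelicGroupData F E c N J).L2 μ)
    (hcl : ∀ (g : finAdelic F E c N J) (w : W),
      cl (σ g w) = (adelicGroupData F E c N J).rightRegular μ (finAdelicToAdelic F E c N J g) (cl w))
    {w₀ : W} (hu : ∃ u ∈ P.space, ⟪(u : (adelicGroupData F E c N J).L2 μ), cl w₀⟫_ℂ ≠ 0) :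
    P.HasFinComponent σ := by
  haveI := hσ
  let f : W →ₗ[ℂ] P.space.toSubmodule := (P.space.toSubmodule.orthogonalProjectionOnto).toLinearMap ∘ₗ cl
  have hf_apply : ∀ w, f w = P.space.toSubmodule.orthogonalProjectionOnto (cl w) := fun w => rfl
  have hf_eqv : ∀ (g : finAdelic F E c N J) (w : W), f (σ g w) = P.finRep g (f w) := by
    intro g w
    apply Subtype.ext
    rw [hf_apply, hf_apply, hcl,
      orthogonalProjectionOnto_map ((adelicGroupData F E c N J).isUnitary_rightRegular μ)]
    rfl
  have hf0 : f w₀ ≠ 0 := by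
    rw [hf_apply]
    exact orthogonalProjectionOnto_ne_zero P.space hu
  let fI : σ.IntertwiningMap P.finRep := f.intertwiningMap_of_isIntertwiningMap σ P.finRep hf_eqv
  refine ⟨fI, ?_⟩
  rcases Representation.IsIrreducible.injective_or_eq_zero fI with hinj | hzero
  · exact hinj
  · exfalso
    apply hf0
    have h3 : fI w₀ = 0 := by rw [hzero]; rfl
    exact h3

/-- **J1′₂ — THE FORMAL `L²` SPECTRAL JUNCTION FOR SCALAR FORMS.**  Let `μ` be an automorphic measure on the COMPACT quotient
`U(J)(F)\U(J)(𝔸_F)` with `L²(μ)` discretely decomposable (★ `UnitaryGroup.isDiscretelyDecomposable_rightRegular_adelicGroupData` for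
anisotropic `J`), `σ` an IRREDUCIBLE representation of `U(J)(𝔸_{F,f})` on `W`, and `ψ : W →ₗ[ℂ] (U(J)(𝔸_F) → ℂ)` a NON-ZERO linear map,
equivariant for right translation (`ψ (σ g w) x = ψ w (x · (1,g))`), whose values are left-`U(J)(F)`-invariant and CONTINUOUS on
`U(J)(𝔸_F)`.  Then some discrete automorphic representation `P ≤ L²(μ)` is NOT ORTHOGONAL to the class `[toQuotFun (ψ w)]` of some value,
and `σ` OCCURS in `P` (`P.HasFinComponent σ`, via `pr_P ∘ [·] ∘ ψ`).  Scalar twin of ★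
`F0P3SpectralJunction.exists_discreteAutomorphicRep_not_orthogonal_hasFinComponent`. [cite: BorelJacquet1979, §4.6] [cite: Dixmier1977, §13.1]
[cite: Liu2021, Prop. D.4 (1) p. 130–131] -/
theorem exists_discreteAutomorphicRep_not_orthogonal_hasFinComponent
    (hdisc : ((adelicGroupData F E c N J).rightRegular μ).IsDiscretelyDecomposable)
    {W : Type} [AddCommGroup W] [Module ℂ W] (σ : Representation ℂ (finAdelic F E c N J) W) (hσ : σ.IsIrreducible)
    (ψ : W →ₗ[ℂ] ((adelicGroupData F E c N J).Adelic → ℂ))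
    (heqv : ∀ (g : finAdelic F E c N J) (w : W) (x : (adelicGroupData F E c N J).Adelic),
      ψ (σ g w) x = ψ w (x * finAdelicToAdelic F E c N J g))
    (hinv : ∀ (w : W), ∀ γ ∈ (adelicGroupData F E c N J).quotientSubgroup, ∀ x, ψ w (γ * x) = ψ w x)
    (hcont : ∀ w : W, Continuous (ψ w)) (hψ : ψ ≠ 0) :
    ∃ (P : DiscreteAutomorphicRep (adelicGroupData F E c N J) μ) (w : W)
      (h : MemLp (toQuotFun (adelicGroupData F E c N J) (ψ w)) 2 μ),
      (∃ u ∈ P.space, ⟪(u : (adelicGroupData F E c N J).L2 μ), h.toLp⟫_ℂ ≠ 0) ∧ P.HasFinComponent σ := by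
  -- a non-zero value of `ψ`
  obtain ⟨w₀, hw₀⟩ : ∃ w, ψ w ≠ 0 := by
    by_contra h
    push Not at h
    exact hψ (LinearMap.ext h)
  obtain ⟨x₀, hx₀⟩ : ∃ x, ψ w₀ x ≠ 0 := by
    by_contra h
    push Not at h
    exact hw₀ (funext fun x => h x)
  obtain ⟨cl, hcl, hcl_eqv, hcl_ne⟩ := exists_classMap (μ := μ) σ ψ heqv hinv hcont
  have hcl0 : cl w₀ ≠ 0 := hcl_ne w₀ x₀ hx₀
  -- an irreducible summand not orthogonal to `cl w₀`
  obtain ⟨Wc, hWirr, hu⟩ := exists_irreducible_not_orthogonal hdisc hcl0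
  let P : DiscreteAutomorphicRep (adelicGroupData F E c N J) μ := ⟨Wc, hWirr⟩
  refine ⟨P, w₀, memLp_toQuotFun (hinv w₀) (hcont w₀), ?_, ?_⟩
  · rw [← hcl w₀]
    exact hu
  · exact hasFinComponent_of_classMap P σ hσ cl hcl_eqv (w₀ := w₀) hu

/-- **J1″₂ — EVERY discrete `P` meeting the class of a value of `ψ` has finite component `σ`.**  Same data as J1′₂ but for a GIVEN
discrete automorphic `P` with `∃ u ∈ P.space, ⟪u, [toQuotFun (ψ w₀)]⟫ ≠ 0`: the intertwiner `pr_P ∘ [·] ∘ ψ : σ → P|_{U(J)(𝔸_{F,f})}` is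
non-zero at `w₀`, hence injective (`σ` irreducible); no discrete decomposability is used.  Scalar twin of ★
`F0P3SpectralJunction.hasFinComponent_of_not_orthogonal`. [cite: BorelJacquet1979, §4.6] [cite: Dixmier1977, §13.1] -/
theorem hasFinComponent_of_not_orthogonal (P : DiscreteAutomorphicRep (adelicGroupData F E c N J) μ)
    {W : Type} [AddCommGroup W] [Module ℂ W] (σ : Representation ℂ (finAdelic F E c N J) W) (hσ : σ.IsIrreducible)
    (ψ : W →ₗ[ℂ] ((adelicGroupData F E c N J).Adelic → ℂ))
    (heqv : ∀ (g : finAdelic F E c N J) (w : W) (x : (adelicGroupData F E c N J).Adelic),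
      ψ (σ g w) x = ψ w (x * finAdelicToAdelic F E c N J g))
    (hinv : ∀ (w : W), ∀ γ ∈ (adelicGroupData F E c N J).quotientSubgroup, ∀ x, ψ w (γ * x) = ψ w x)
    (hcont : ∀ w : W, Continuous (ψ w))
    {w₀ : W} (h : MemLp (toQuotFun (adelicGroupData F E c N J) (ψ w₀)) 2 μ)
    (hu : ∃ u ∈ P.space, ⟪(u : (adelicGroupData F E c N J).L2 μ), h.toLp⟫_ℂ ≠ 0) :
    P.HasFinComponent σ := by
  obtain ⟨cl, hcl, hcl_eqv, -⟩ := exists_classMap (μ := μ) σ ψ heqv hinv hcont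
  have hcl₀ : h.toLp = cl w₀ := (hcl w₀).symm
  rw [hcl₀] at hu
  exact hasFinComponent_of_classMap P σ hσ cl hcl_eqv (w₀ := w₀) hu

end Junction

end Summit.HodgeConjecture.HodgeConjecture.Cruxes.HLiu418.ScalarSpectralJunction

end
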